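/-
Copyright: the b2b-balaban T⁴-continuum CRUX team, row NE7b, leaf lineage `t4-ne7b-formalise-leaf-02` (gen 132). Project licence.
-/
import Summits.QuantumFields.BalabanUV.T4Continuum.Spine.NE7b.BlockSquareRowMultiplicity
import Summits.QuantumFields.BalabanUV.T4Continuum.Spine.NE7b.BlockSurfaceCounting

/-!
# THE (5.2) COUNTING ON THE TWO-SCALE TORUS WITH THE INTERIOR ROWS, BY VALUE: when the 1-form part of the Lemma-CS-shaped per-plaquette
# letter runs over the WHOLE based square — its `2n²` interior row bonds and its `4n` boundary bonds, as the honest `k = 1` letter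
# (`…OneStepCoarseCurlBound`) does — the abstract counting gives `Σ_P (X P)² ≤ 2·n^{−d}·Σ_q (F q)² + 4(d−1)(n+2)²·n^{−d}·ε²·Σ_b (A b)²`
# (row NE7b, node U5c; `HOME/b2b-balaban-r1/SectE-interface-proof.md` §5.2 display (5.2), the (h1) slot of print's `γ₀` assembly)

Cell `pub-balaban`, sub-cell `t4`, spine estimate NE7b (`T4WeightBudget.RelWeightBound`; the cell's OWN estimate — NOT PRINTED in
[Bałaban 1983–89], NOT PROVED).  Crux-route work under `Spine/NE7b/` by the row's E-side ∕ key-readings ∕ lattice-geometry leaf lineage;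
[folklore] finite combinatorics over `ℝ`; NOTHING of Bałaban's is named or asserted; no `T4Continuum/Support` leaf typed; no `def`, no notation;
zero `sorry`.  Imports: this lineage's `…BlockSquareRowMultiplicity` (the interior grid `Gr` and its multiplicity `(d−1)n²`) and
`…BlockSurfaceCounting` (through it `…BlockSurfaceMultiplicity`: `Sq`, `Bd`, `blockPoint_injective`, and leaf-05 g154's
`…CovariantStokesCounting.sum_sq_le_of_blockAverage_bound` — the abstract counting, BY NAME).

WHY (located).  The memo's (5.2) counts «a fine bond lies on `∂S_x(P)` for at most `2(d−1)L^k` pairs» — the BOUNDARY of the block surface only,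
because its Lemma CS (i) is exact Stokes.  The typed Lemma CS (i) (`…LinearisedLatticeStokesRectangle` END, read in [B7]'s currency by
`…RotatedSumRectangleStokes`) carries a curvature defect weighting the 1-form on the INTERIOR ROWS of `S_x(P)` with the small factor `2Lα₀`, so
the honest `k = 1` letter `…OneStepCoarseCurlBound.norm_coarseCurl_Q0cov_bavg_le_curls` has its 1-form part on `Gr ∪ Bd` (interior grid ∪ boundary)
— `#(Gr ∪ Bd) ≤ 2n² + 4n`, multiplicity `≤ (d−1)n² + 2(d−1)n` per bond.  THIS FILE is `…BlockSurfaceCounting.sum_sq_le_twoScale` with that one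
change: `T := Gr ∪ Bd`, `t := 2n + 4`, `m₂ := (d−1)n(n+2)·n^{−d}`, hence `2·t·m₂·ε²·v = 4(d−1)(n+2)²·n^{−d}·ε²` in place of `16(d−1)n^{−d}ε²` — a
factor `(n+2)²∕4`, polynomial in `n = L^k`, absorbed at `k = 1` by `ε² = O(α₀²L⁴)`; the curl side is unchanged (`2n^{−d}`).

WHAT IS PROVED ([folklore]; two-scale torus `(ℤ∕nM)^d`, `0 < n`, block points `x = n·y + r`):
* §1 **`block_grid_multiplicity_le`** — in block indexing `((y, a), r)` a fine bond lies in the interior grid of at most `(d−1)n²` based squares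
  (`…BlockSquareRowMultiplicity.grid_multiplicity_le` + `blockPoint_injective`); **`card_grid_union_boundary_mul_inv_le`** — `#(Gr ∪ Bd)·n⁻¹ ≤ 2n + 4`;
  **`block_grid_union_boundary_multiplicity_le`** — `≤ (d−1)n² + 2(d−1)n` based squares per bond over `Gr ∪ Bd`.
* §2 **`sum_sq_le_twoScale_rows`** — for per-plaquette data `X P`, `a P r ≥ 0` with `|X P| ≤ Σ_r n^{−d}·(a P r + ε·Σ_{b∈Gr ∪ Bd} n^{−1}|A b|)`,
  `a P r ≤ Σ_{q∈Sq} n^{−2}|F q|`:  `Σ_P (X P)² ≤ 2·n^{−d}·Σ_q (F q)² + 4·(d−1)·(n+2)²·n^{−d}·ε²·Σ_b (A b)²`.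

NOT HERE (honest): that print's ∕ the typed `(∂_V M_1A)(P)` obeys these letters (the periodisation junction `ℤ^d → (ℤ∕N)^d` of
`…OneStepCoarseCurlBound` through `T4TermwiseTorus` ∕ `B7AvgPeriodicity` is a later file), the `L²` normalisations, `k > 1`, anything of Bałaban's
((A3) ∕ (A1c); NC-NE7b-α UNRULED).  BY-NAME EFFECT ON THE WALL: NONE.  NE7b NOT PRINTED ∕ NOT PROVED; spine PROVED 0∕9; rung (B)+1 on a FINITE
torus — NOT infinite volume, NOT the mass gap, NOT Clay.
HONEST DEPENDENCY: continuum YM on T⁴ ⇐ BetaPertH ∧ nine spine estimates (0/9 proved); BetaPertH ⇐ (D1) ∧ (D4) ∧ CAP+tail.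
-/

set_option autoImplicit false

namespace Summit.QuantumFields.BalabanUV.T4Continuum.NE7b.BlockSquareCounting

open Finset
open Summit.QuantumFields.BalabanUV.T4Continuum.NE7b.BlockSurfaceMultiplicity
open Summit.QuantumFields.BalabanUV.T4Continuum.NE7b.BlockSquareRowMultiplicity
open Summit.QuantumFields.BalabanUV.T4Continuum.NE7b.BlockSurfaceCounting (sum_sum_ite_const_eq_mul_card)
open Summit.QuantumFields.BalabanUV.T4Continuum.NE7b.CovariantStokesCounting (sum_sq_le_of_blockAverage_bound)

variable {d M : ℕ} (n : ℕ)
  (Sq : (Fin d → ZMod (n * M)) → {a : Fin d × Fin d // a.1 < a.2} →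
    Finset ((Fin d → ZMod (n * M)) × {a : Fin d × Fin d // a.1 < a.2}))
  (hSq : ∀ x a, Sq x a = univ.image (fun ij : Fin n × Fin n =>
    (x + Pi.single a.1.1 ((ij.1 : ℕ) : ZMod (n * M)) + Pi.single a.1.2 ((ij.2 : ℕ) : ZMod (n * M)), a)))
  (Bd : (Fin d → ZMod (n * M)) → {a : Fin d × Fin d // a.1 < a.2} → Finset ((Fin d → ZMod (n * M)) × Fin d))
  (hBd : ∀ x a, Bd x a = univ.image (fun csi : Bool × Bool × Fin n =>
      if csi.1 then
        (if csi.2.1 then x + Pi.single a.1.1 ((csi.2.2 : ℕ) : ZMod (n * M))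
          else x + Pi.single a.1.2 (n : ZMod (n * M)) + Pi.single a.1.1 ((csi.2.2 : ℕ) : ZMod (n * M)), a.1.1)
      else
        (if csi.2.1 then x + Pi.single a.1.2 ((csi.2.2 : ℕ) : ZMod (n * M))
          else x + Pi.single a.1.1 (n : ZMod (n * M)) + Pi.single a.1.2 ((csi.2.2 : ℕ) : ZMod (n * M)), a.1.2)))
  (Gr : (Fin d → ZMod (n * M)) → {a : Fin d × Fin d // a.1 < a.2} → Finset ((Fin d → ZMod (n * M)) × Fin d))
  (hGr : ∀ x a, Gr x a = univ.image (fun cij : Bool × Fin n × Fin n =>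
      (x + Pi.single a.1.1 ((cij.2.1 : ℕ) : ZMod (n * M)) + Pi.single a.1.2 ((cij.2.2 : ℕ) : ZMod (n * M)),
        if cij.1 then a.1.1 else a.1.2)))

/-! ## §1 The interior grid in block indexing; the whole based square `Gr ∪ Bd` -/

include hGr in
/-- **INTERIOR-GRID MULTIPLICITY IN BLOCK INDEXING**: over pairs `((y, a), r)` a fine bond lies in the interior grid of at most `(d−1)·n²`
based squares `Gr (n·y + r) a` (`grid_multiplicity_le` + `blockPoint_injective`). [folklore] -/
theorem block_grid_multiplicity_le [NeZero M] (hn : 0 < n) (b : (Fin d → ZMod (n * M)) × Fin d) :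
    (univ.filter fun p : ((Fin d → ZMod M) × {a : Fin d × Fin d // a.1 < a.2}) × (Fin d → Fin n) =>
      b ∈ Gr (fun i => (((p.1.1 i).val * n + (p.2 i : ℕ) : ℕ) : ZMod (n * M))) p.1.2).card ≤ (d - 1) * n ^ 2 := by
  classical
  haveI : NeZero (n * M) := ⟨Nat.mul_ne_zero hn.ne' (NeZero.ne M)⟩
  refine le_trans ?_ (grid_multiplicity_le n Gr hGr b)
  refine Finset.card_le_card_of_injOn
    (fun p => ((fun i => (((p.1.1 i).val * n + (p.2 i : ℕ) : ℕ) : ZMod (n * M))), p.1.2)) (fun p hp => ?_) (fun p₁ _ p₂ _ h => ?_)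
  · simp only [Finset.coe_filter, Finset.mem_univ, true_and, Set.mem_setOf_eq] at hp ⊢
    exact hp
  · simp only [Prod.mk.injEq] at h
    obtain ⟨h1, h2⟩ := h
    have h3 := blockPoint_injective n hn (a₁ := (p₁.1.1, p₁.2)) (a₂ := (p₂.1.1, p₂.2)) h1
    simp only [Prod.mk.injEq] at h3
    exact Prod.ext (Prod.ext h3.1 h2) h3.2

include hGr hBd in
/-- **`#(Gr ∪ Bd)·n⁻¹ ≤ 2n + 4`** — the form-weight letter `hT` of `…CovariantStokesCounting` for the whole based square (`2n²` interior + `4n`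
boundary bonds, weight `v = n⁻¹`). [folklore] -/
theorem card_grid_union_boundary_mul_inv_le (hn : 0 < n) (x : Fin d → ZMod (n * M)) (a : {a : Fin d × Fin d // a.1 < a.2}) :
    ((Gr x a ∪ Bd x a).card : ℝ) * (1 / (n : ℝ)) ≤ 2 * n + 4 := by
  have hn' : (0 : ℝ) < (n : ℝ) := by exact_mod_cast hn
  have h1 : ((Gr x a ∪ Bd x a).card : ℝ) ≤ 2 * (n : ℝ) ^ 2 + 4 * n := by
    have hu := Finset.card_union_le (Gr x a) (Bd x a)
    have hg := card_grid_le n Gr hGr x a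
    have hb := card_boundary_le n Bd hBd x a
    have : (Gr x a ∪ Bd x a).card ≤ 2 * n ^ 2 + 4 * n := hu.trans (Nat.add_le_add hg hb)
    exact_mod_cast this
  rw [mul_one_div, div_le_iff₀ hn']
  nlinarith [h1]

include hGr hBd in
/-- **MULTIPLICITY OVER THE WHOLE BASED SQUARE, BLOCK INDEXING**: a fine bond lies in `Gr ∪ Bd` of at most `(d−1)n² + 2(d−1)n` based squares
`(n·y + r, a)`. [folklore] -/
theorem block_grid_union_boundary_multiplicity_le [NeZero M] (hn : 0 < n) (b : (Fin d → ZMod (n * M)) × Fin d) :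
    (univ.filter fun p : ((Fin d → ZMod M) × {a : Fin d × Fin d // a.1 < a.2}) × (Fin d → Fin n) =>
      b ∈ Gr (fun i => (((p.1.1 i).val * n + (p.2 i : ℕ) : ℕ) : ZMod (n * M))) p.1.2
        ∪ Bd (fun i => (((p.1.1 i).val * n + (p.2 i : ℕ) : ℕ) : ZMod (n * M))) p.1.2).card
      ≤ (d - 1) * n ^ 2 + 2 * (d - 1) * n := by
  classical
  have hsplit : (univ.filter fun p : ((Fin d → ZMod M) × {a : Fin d × Fin d // a.1 < a.2}) × (Fin d → Fin n) =>
      b ∈ Gr (fun i => (((p.1.1 i).val * n + (p.2 i : ℕ) : ℕ) : ZMod (n * M))) p.1.2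
        ∪ Bd (fun i => (((p.1.1 i).val * n + (p.2 i : ℕ) : ℕ) : ZMod (n * M))) p.1.2)
      ⊆ (univ.filter fun p : ((Fin d → ZMod M) × {a : Fin d × Fin d // a.1 < a.2}) × (Fin d → Fin n) =>
          b ∈ Gr (fun i => (((p.1.1 i).val * n + (p.2 i : ℕ) : ℕ) : ZMod (n * M))) p.1.2)
        ∪ (univ.filter fun p : ((Fin d → ZMod M) × {a : Fin d × Fin d // a.1 < a.2}) × (Fin d → Fin n) =>
          b ∈ Bd (fun i => (((p.1.1 i).val * n + (p.2 i : ℕ) : ℕ) : ZMod (n * M))) p.1.2) := by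
    intro p hp
    simp only [Finset.mem_filter, Finset.mem_univ, true_and, Finset.mem_union] at hp ⊢
    exact hp
  refine (Finset.card_le_card hsplit).trans ((Finset.card_union_le _ _).trans ?_)
  exact Nat.add_le_add (block_grid_multiplicity_le n Gr hGr hn b) (block_boundary_multiplicity_le n hn Bd hBd b)

/-! ## §2 The counting with the interior rows, by value -/

include hSq hBd hGr in
/-- **THE (5.2) COUNTING WITH THE INTERIOR ROWS, BY VALUE** — `Σ_P (X P)² ≤ 2·n^{−d}·Σ_q (F q)² + 4·(d−1)·(n+2)²·n^{−d}·ε²·Σ_b (A b)²` from the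
honest `k = 1`-shaped per-plaquette letters (1-form part over `Gr ∪ Bd`), every counting letter of
`…CovariantStokesCounting.sum_sq_le_of_blockAverage_bound` discharged (`w = n^{−d}`, `u = n^{−2}`, `v = n^{−1}`, `t = 2n + 4`, `m₁ = n²n^{−d}`,
`m₂ = ((d−1)n² + 2(d−1)n)·n^{−d}`). [folklore] -/
theorem sum_sq_le_twoScale_rows [NeZero M] [NeZero (n * M)] (hn : 0 < n)
    (Xv : (Fin d → ZMod M) × {a : Fin d × Fin d // a.1 < a.2} → ℝ)
    (av : (Fin d → ZMod M) × {a : Fin d × Fin d // a.1 < a.2} → (Fin d → Fin n) → ℝ)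
    (F : (Fin d → ZMod (n * M)) × {a : Fin d × Fin d // a.1 < a.2} → ℝ) (A : (Fin d → ZMod (n * M)) × Fin d → ℝ) {ε : ℝ} (hε : 0 ≤ ε)
    (ha0 : ∀ p r, 0 ≤ av p r)
    (ha : ∀ p r, av p r ≤ ∑ q ∈ Sq (fun i => (((p.1 i).val * n + (r i : ℕ) : ℕ) : ZMod (n * M))) p.2, (1 / (n : ℝ) ^ 2) * |F q|)
    (hX : ∀ p, |Xv p| ≤ ∑ r : Fin d → Fin n, (1 / (n : ℝ) ^ d) *
      (av p r + ε * ∑ b ∈ Gr (fun i => (((p.1 i).val * n + (r i : ℕ) : ℕ) : ZMod (n * M))) p.2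
                      ∪ Bd (fun i => (((p.1 i).val * n + (r i : ℕ) : ℕ) : ZMod (n * M))) p.2, (1 / (n : ℝ)) * |A b|)) :
    ∑ p, Xv p ^ 2
      ≤ 2 * (1 / (n : ℝ) ^ d) * ∑ q, F q ^ 2
        + 4 * ((d - 1 : ℕ) : ℝ) * ((n : ℝ) + 2) ^ 2 * (1 / (n : ℝ) ^ d) * ε ^ 2 * ∑ b, A b ^ 2 := by
  classical
  have hn0 : (0 : ℝ) < (n : ℝ) := by exact_mod_cast hn
  have hnd : (0 : ℝ) < (n : ℝ) ^ d := pow_pos hn0 d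
  -- the abstract counting with every letter supplied
  have h := sum_sq_le_of_blockAverage_bound
    (P := (Fin d → ZMod M) × {a : Fin d × Fin d // a.1 < a.2}) (X := Fin d → Fin n)
    (fun _ _ => 1 / (n : ℝ) ^ d)
    (fun p r => Sq (fun i => (((p.1 i).val * n + (r i : ℕ) : ℕ) : ZMod (n * M))) p.2)
    (fun p r => Gr (fun i => (((p.1 i).val * n + (r i : ℕ) : ℕ) : ZMod (n * M))) p.2
      ∪ Bd (fun i => (((p.1 i).val * n + (r i : ℕ) : ℕ) : ZMod (n * M))) p.2)
    Xv av F A (u := 1 / (n : ℝ) ^ 2) (v := 1 / (n : ℝ)) (t := 2 * n + 4) (ε := ε)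
    (m₁ := 1 / (n : ℝ) ^ d * (n : ℝ) ^ 2) (m₂ := 1 / (n : ℝ) ^ d * (((d - 1 : ℕ) : ℝ) * (n : ℝ) ^ 2 + 2 * ((d - 1 : ℕ) : ℝ) * n))
    (fun _ _ => by positivity)
    (fun _ => by
      rw [Finset.sum_const, Finset.card_univ, Fintype.card_fun, Fintype.card_fin, Fintype.card_fin, nsmul_eq_mul, Nat.cast_pow,
        mul_one_div, div_self hnd.ne'])
    (by positivity) (by positivity) (by positivity) hε
    (fun p r => card_square_mul_inv_sq_le_one n Sq hn hSq _ _)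
    (fun p r => card_grid_union_boundary_mul_inv_le n Bd hBd Gr hGr hn _ _)
    (fun q => by
      rw [sum_sum_ite_const_eq_mul_card]
      exact mul_le_mul_of_nonneg_left (by exact_mod_cast block_square_multiplicity_le n hn Sq hSq q) (by positivity))
    (fun b => by
      rw [sum_sum_ite_const_eq_mul_card]
      refine mul_le_mul_of_nonneg_left ?_ (by positivity)
      have := block_grid_union_boundary_multiplicity_le n Bd hBd Gr hGr hn b
      exact_mod_cast this)
    ha0 ha hX
  -- the constants: `2·m₁·u = 2n^{−d}`, `2·t·m₂·v = 4(d−1)(n+2)²·n^{−d}`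
  have h1 : 2 * (1 / (n : ℝ) ^ d * (n : ℝ) ^ 2) * (1 / (n : ℝ) ^ 2) = 2 * (1 / (n : ℝ) ^ d) := by
    field_simp
  have h2 : 2 * (2 * (n : ℝ) + 4) * (1 / (n : ℝ) ^ d * (((d - 1 : ℕ) : ℝ) * (n : ℝ) ^ 2 + 2 * ((d - 1 : ℕ) : ℝ) * n)) * ε ^ 2
        * (1 / (n : ℝ)) = 4 * ((d - 1 : ℕ) : ℝ) * ((n : ℝ) + 2) ^ 2 * (1 / (n : ℝ) ^ d) * ε ^ 2 := by
    field_simp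
    ring
  rw [h1, h2] at h
  exact h

end Summit.QuantumFields.BalabanUV.T4Continuum.NE7b.BlockSquareCounting
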